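import Summits.QuantumFields.YangMills.Theorems.VirialFluxGapPeriodicSoftnessOfCentralField
import Summits.QuantumFields.YangMills.Theorems.VirialFluxGapCentralSignSelector
import HarnessLib

/-!
# Route `VirialFluxGap` (YangMills): ASSEMBLY OF THE PATCHED EULER FIELD ON `X_fix`, PART VII — PLUGGING w2's smooth sign selectors into a
# per-sign central family: values and FRAME DERIVATIVES at a central point are those of the selected sign chart; `PeriodicSoftness` from per-sign packages

Toward the deciding crux `VirialFluxGap.PeriodicSoftness` (item stmt-QuantumFields-24141).  w3's explicit central field is a family
`Φ σ σ₄ : (FixVar L × Fin 3) → coords → ℝ` (`centralCoeff L σ σ₄`) indexed by signs `σ ∈ {±1}³`, `σ₄ ∈ {±1}`, smooth after plugging in w2's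
selectors (`✓contDiff_centralCoeff_sign`): `C va M := Φ (fun k => linkSign k M) (seamSign M) va M`.  On the `ρ`-central region (`ρ² ≤ 3/4`) the
selectors are `±1`, satisfy the sign hypotheses `½ ≤ σ_k·Re su2Quat(w_k)`, `½ ≤ σ₄·Re su2Quat(seam root)`, and are LOCALLY CONSTANT
(✓`signStep_comp_eventuallyEq`), so `C` agrees near the point with the chart `Φ σ* σ₄*` selected by the point — values AND frame derivatives:

* `signPlug_eventuallyEq` — near a central `M`: `(M' ↦ Φ (linkSign · M') (seamSign M') va M') =ᶠ[𝓝 M] Φ (linkSign · M) (seamSign M) va`;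
  `frameD_signPlug_eq` — hence equal frame derivatives at `M`;
* ★★ `exists_centralField_of_signPlug` — per-sign packages (P2)(P3)(P4) for `Φ σ σ₄` (all `σ, σ₄ = ±1`, under the sign hypotheses) + smoothness of
  the plugged family ⇒ the σ-free «CentralFieldPackage» of ✓`periodicSoftness_of_centralField` for `C`;
* ★★★ `periodicSoftness_of_signPlug` — `PeriodicSoftness` BY NAME from per-sign packages for all large `L`.

HONEST LABEL: plumbing for a CONDITIONAL assembly (the per-sign packages are HYPOTHESES, w3 lineage); nothing is closed; ⟨24141⟩, ⟨22884⟩ remain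
OPEN; the Yang–Mills mass gap is NOT proved; no summit is proved by a line.  THEOREMS ONLY (0 `def`, 0 `sorry`), standard axioms.  Explicit-unit
seat `ym-line-fcl-p3` g41 (cell ym-idea-1, free hands; default assembler), `--supports stmt-QuantumFields-24141`.  References: [cite: Luscher1983, §2]; [folklore].
-/

set_option autoImplicit false

noncomputable section

open scoped Matrix BigOperators ContDiff Topology Quaternion
open MeasureTheory Set Matrix
open Literature.MathematicalPhysics.QuantumFieldTheory hiding SU2
open Literature.MathematicalPhysics.QuantumLattice
open Literature.MathematicalPhysics.QuantumFieldTheory.SUNBakryEmery (expSU coe_expSU matTop)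

namespace Summit.QuantumFields.YangMills.Theorems.VirialFluxGap.FrameHessian

open Summit.QuantumFields.YangMills.Theorems.FemtoTransferGap
open Summit.QuantumFields.YangMills.Theorems.FemtoTransferGap.TT
open Summit.QuantumFields.YangMills.Theorems.FemtoTransferGap.TwoLattice
open Summit.QuantumFields.YangMills.Theorems.FemtoTransferGap.TwoLattice.Flat
open Summit.QuantumFields.YangMills.Theorems.VirialFluxGap.RingDeficit
open Summit.QuantumFields.YangMills.Theorems.VirialFluxGap.FrameDerivative
open Summit.QuantumFields.YangMills.Theorems.VirialFluxGap.ResolventField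
open Summit.QuantumFields.YangMills.Theorems.VirialFluxGap.RegularValley
open Summit.QuantumFields.YangMills.Theorems.VirialFluxGap.FixFrame
open Summit.QuantumFields.YangMills.Theorems.VirialFluxGap.RegCutoff

variable {L : ℕ} [NeZero L]

open scoped Matrix.Norms.Frobenius

/-! ## §1 The plugged family is locally the selected chart -/

/-- On the central region (`linkMass k M ≤ ¾`) the link selector is locally constant: `linkSign k =ᶠ[𝓝 M] const`. [folklore] -/
theorem linkSign_eventuallyEq_const (k : Fin 3)
    {M : (Fin (2 * L - 1 + 1) → Edge 3 L → Matrix (Fin 2) (Fin 2) ℂ) × (Site 3 L → Matrix (Fin 2) (Fin 2) ℂ)} (hM : linkMass k M ≤ 3 / 4) :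
    linkSign (L := L) k =ᶠ[𝓝 M] fun _ => linkSign k M := by
  have hf : Continuous fun M' : ((Fin (2 * L - 1 + 1) → Edge 3 L → Matrix (Fin 2) (Fin 2) ℂ) × (Site 3 L → Matrix (Fin 2) (Fin 2) ℂ)) =>
      ((M'.1 0 (wrapEdge k)).trace).re / 2 := ((contDiff_reTr.comp (contDiff_coord_fst 0 (wrapEdge k))).div_const 2).continuous
  have hsq : 1 / 4 ≤ (((M.1 0 (wrapEdge k)).trace).re / 2) ^ 2 := by unfold linkMass at hM; linarith
  have hM' : 0 < ((M.1 0 (wrapEdge k)).trace).re / 2 ∨ ((M.1 0 (wrapEdge k)).trace).re / 2 < -(1 / 4) := by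
    by_cases h : 0 ≤ ((M.1 0 (wrapEdge k)).trace).re / 2
    · left; nlinarith only [hsq, h]
    · right; nlinarith only [hsq, h]
  obtain ⟨a, ha⟩ := signStep_comp_eventuallyEq hf hM'
  have haM : linkSign k M = a := ha.eq_of_nhds
  rw [haM]
  exact ha

/-- On the central region (`seamMass M ≤ ¾`) the seam selector is locally constant. [folklore] -/
theorem seamSign_eventuallyEq_const
    {M : (Fin (2 * L - 1 + 1) → Edge 3 L → Matrix (Fin 2) (Fin 2) ℂ) × (Site 3 L → Matrix (Fin 2) (Fin 2) ℂ)} (hM : seamMass M ≤ 3 / 4) :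
    seamSign (L := L) =ᶠ[𝓝 M] fun _ => seamSign M := by
  have hf : Continuous fun M' : ((Fin (2 * L - 1 + 1) → Edge 3 L → Matrix (Fin 2) (Fin 2) ℂ) × (Site 3 L → Matrix (Fin 2) (Fin 2) ℂ)) =>
      ((M'.2 0).trace).re / 2 := ((contDiff_reTr.comp (contDiff_coord_snd 0)).div_const 2).continuous
  have hsq : 1 / 4 ≤ (((M.2 0).trace).re / 2) ^ 2 := by unfold seamMass at hM; linarith
  have hM' : 0 < ((M.2 0).trace).re / 2 ∨ ((M.2 0).trace).re / 2 < -(1 / 4) := by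
    by_cases h : 0 ≤ ((M.2 0).trace).re / 2
    · left; nlinarith only [hsq, h]
    · right; nlinarith only [hsq, h]
  obtain ⟨a, ha⟩ := signStep_comp_eventuallyEq hf hM'
  have haM : seamSign M = a := ha.eq_of_nhds
  rw [haM]
  exact ha

/-- ★ **The plugged family is locally the selected chart**: on the central region,
`(M' ↦ Φ (linkSign · M') (seamSign M') va M') =ᶠ[𝓝 M] Φ (linkSign · M) (seamSign M) va`. [folklore] -/
theorem signPlug_eventuallyEq {β : Type*} (Φ : (Fin 3 → ℝ) → ℝ → ((Fin (2 * L - 1 + 1) → Edge 3 L → Matrix (Fin 2) (Fin 2) ℂ) × (Site 3 L → Matrix (Fin 2) (Fin 2) ℂ)) → β)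
    {M : (Fin (2 * L - 1 + 1) → Edge 3 L → Matrix (Fin 2) (Fin 2) ℂ) × (Site 3 L → Matrix (Fin 2) (Fin 2) ℂ)}
    (hk : ∀ k : Fin 3, linkMass k M ≤ 3 / 4) (hs : seamMass M ≤ 3 / 4) :
    (fun M' => Φ (fun k => linkSign k M') (seamSign M') M') =ᶠ[𝓝 M] fun M' => Φ (fun k => linkSign k M) (seamSign M) M' := by
  filter_upwards [linkSign_eventuallyEq_const 0 (hk 0), linkSign_eventuallyEq_const 1 (hk 1), linkSign_eventuallyEq_const 2 (hk 2),
    seamSign_eventuallyEq_const hs] with M' h0 h1 h2 h3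
  have hfun : (fun k => linkSign k M') = fun k => linkSign k M := by
    funext k
    have h3k : ∀ i : Fin 3, i = 0 ∨ i = 1 ∨ i = 2 := by decide
    rcases h3k k with rfl | rfl | rfl
    · exact h0
    · exact h1
    · exact h2
  rw [hfun, h3]

/-- ★ **Frame derivatives of the plugged family are those of the selected chart** at every central point. [folklore] -/
theorem frameD_signPlug_eq (Φ : (Fin 3 → ℝ) → ℝ → ((Fin (2 * L - 1 + 1) → Edge 3 L → Matrix (Fin 2) (Fin 2) ℂ) × (Site 3 L → Matrix (Fin 2) (Fin 2) ℂ)) → ℝ)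
    {M : (Fin (2 * L - 1 + 1) → Edge 3 L → Matrix (Fin 2) (Fin 2) ℂ) × (Site 3 L → Matrix (Fin 2) (Fin 2) ℂ)}
    (hk : ∀ k : Fin 3, linkMass k M ≤ 3 / 4) (hs : seamMass M ≤ 3 / 4)
    (Y : ((Fin (2 * L - 1 + 1) × Edge 3 L) ⊕ Site 3 L) → Matrix (Fin 2) (Fin 2) ℂ) :
    frameD Y (fun M' => Φ (fun k => linkSign k M') (seamSign M') M') M = frameD Y (Φ (fun k => linkSign k M) (seamSign M)) M := by
  unfold frameD
  exact congrArg (fun φ : (((Fin (2 * L - 1 + 1) → Edge 3 L → Matrix (Fin 2) (Fin 2) ℂ) × (Site 3 L → Matrix (Fin 2) (Fin 2) ℂ)) →L[ℝ] ℝ) =>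
    φ (mulTangent Y M)) ((signPlug_eventuallyEq Φ hk hs).fderiv_eq (𝕜 := ℝ))

/-! ## §2 The σ-free package from per-sign packages, selectors plugged in -/

/-- ★★ **ONE GLOBAL SMOOTH CENTRAL FIELD BY PLUGGING THE SELECTORS.**  Let `Φ σ σ₄` be a per-sign family whose plugged version
`C va M := Φ (linkSign · M) (seamSign M) va M` is smooth, and suppose the central package (P2)(P3)(P4) holds for `Φ σ σ₄` (all `σ_k, σ₄ = ±1`) at the
`ρ`-central window points carrying the signs (`½ ≤ σ_k·Re su2Quat(w_k)`, `½ ≤ σ₄·Re su2Quat(seam root)`, `ρ² ≤ ¾`).  Then `C` satisfies the σ-free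
package of ✓`periodicSoftness_of_centralField`. [cite: Luscher1983, §2] -/
theorem centralPackage_of_signPlug {ρ t_C N ε_C : ℝ} (hρ2 : ρ ^ 2 ≤ 3 / 4)
    (Φ : (Fin 3 → ℝ) → ℝ → FixVar L × Fin 3 → ((Fin (2 * L - 1 + 1) → Edge 3 L → Matrix (Fin 2) (Fin 2) ℂ) × (Site 3 L → Matrix (Fin 2) (Fin 2) ℂ)) → ℝ)
    (hP : ∀ (σ : Fin 3 → ℝ) (σ₄ : ℝ), (∀ k, σ k = 1 ∨ σ k = -1) → (σ₄ = 1 ∨ σ₄ = -1) →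
      ∀ x : (OffIdx L → SU2) × ((Fin (2 * L - 1) → GaugeConfig 3 L SU2) × (Site 3 L → SU2)),
      (∀ k : Fin 3, 1 - (su2Quat (wrapReps ((Fin.cons (glue x.1) x.2.1 : Fin (2 * L - 1 + 1) → GaugeConfig 3 L SU2) 0) k)).re ^ 2 ≤ ρ ^ 2) →
      1 - (su2Quat (x.2.2 0)).re ^ 2 ≤ ρ ^ 2 →
      (∀ k : Fin 3, 1 / 2 ≤ σ k * (su2Quat (wrapReps ((Fin.cons (glue x.1) x.2.1 : Fin (2 * L - 1 + 1) → GaugeConfig 3 L SU2) 0) k)).re) →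
      1 / 2 ≤ σ₄ * (su2Quat (x.2.2 0)).re →
      ringDeficit L (fun _ => false) ((Fin.cons (glue x.1) x.2.1 : Fin (2 * L - 1 + 1) → GaugeConfig 3 L SU2), x.2.2) ≤ t_C →
      2 * (1 - ε_C) * ringDeficit L (fun _ => false) ((Fin.cons (glue x.1) x.2.1 : Fin (2 * L - 1 + 1) → GaugeConfig 3 L SU2), x.2.2) ≤
          ∑ va, Φ σ σ₄ va (ringCoord L ((Fin.cons (glue x.1) x.2.1 : Fin (2 * L - 1 + 1) → GaugeConfig 3 L SU2), x.2.2)) *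
            frameGrad (L := L) fixFrameStd (ringCoord L ((Fin.cons (glue x.1) x.2.1 : Fin (2 * L - 1 + 1) → GaugeConfig 3 L SU2), x.2.2)) va ∧
        ∑ va, frameD (fixFrameStd va) (Φ σ σ₄ va) (ringCoord L ((Fin.cons (glue x.1) x.2.1 : Fin (2 * L - 1 + 1) → GaugeConfig 3 L SU2), x.2.2)) ≤
          18 * (L : ℝ) ^ 4 - 1 / 2 ∧
        (∀ k : Fin 3, -(N * Real.sqrt (ringDeficit L (fun _ => false) ((Fin.cons (glue x.1) x.2.1 : Fin (2 * L - 1 + 1) → GaugeConfig 3 L SU2), x.2.2))) ≤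
          ∑ va, Φ σ σ₄ va (ringCoord L ((Fin.cons (glue x.1) x.2.1 : Fin (2 * L - 1 + 1) → GaugeConfig 3 L SU2), x.2.2)) *
            frameD (fixFrameStd va) (linkMass k) (ringCoord L ((Fin.cons (glue x.1) x.2.1 : Fin (2 * L - 1 + 1) → GaugeConfig 3 L SU2), x.2.2))) ∧
        -(N * Real.sqrt (ringDeficit L (fun _ => false) ((Fin.cons (glue x.1) x.2.1 : Fin (2 * L - 1 + 1) → GaugeConfig 3 L SU2), x.2.2))) ≤
          ∑ va, Φ σ σ₄ va (ringCoord L ((Fin.cons (glue x.1) x.2.1 : Fin (2 * L - 1 + 1) → GaugeConfig 3 L SU2), x.2.2)) *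
            frameD (fixFrameStd va) seamMass (ringCoord L ((Fin.cons (glue x.1) x.2.1 : Fin (2 * L - 1 + 1) → GaugeConfig 3 L SU2), x.2.2)))
    (x : (OffIdx L → SU2) × ((Fin (2 * L - 1) → GaugeConfig 3 L SU2) × (Site 3 L → SU2)))
    (hk : ∀ k : Fin 3, 1 - (su2Quat (wrapReps ((Fin.cons (glue x.1) x.2.1 : Fin (2 * L - 1 + 1) → GaugeConfig 3 L SU2) 0) k)).re ^ 2 ≤ ρ ^ 2)
    (hs : 1 - (su2Quat (x.2.2 0)).re ^ 2 ≤ ρ ^ 2)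
    (hF : ringDeficit L (fun _ => false) ((Fin.cons (glue x.1) x.2.1 : Fin (2 * L - 1 + 1) → GaugeConfig 3 L SU2), x.2.2) ≤ t_C) :
    2 * (1 - ε_C) * ringDeficit L (fun _ => false) ((Fin.cons (glue x.1) x.2.1 : Fin (2 * L - 1 + 1) → GaugeConfig 3 L SU2), x.2.2) ≤
        ∑ va, Φ (fun k => linkSign k (ringCoord L ((Fin.cons (glue x.1) x.2.1 : Fin (2 * L - 1 + 1) → GaugeConfig 3 L SU2), x.2.2)))
            (seamSign (ringCoord L ((Fin.cons (glue x.1) x.2.1 : Fin (2 * L - 1 + 1) → GaugeConfig 3 L SU2), x.2.2))) va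
            (ringCoord L ((Fin.cons (glue x.1) x.2.1 : Fin (2 * L - 1 + 1) → GaugeConfig 3 L SU2), x.2.2)) *
          frameGrad (L := L) fixFrameStd (ringCoord L ((Fin.cons (glue x.1) x.2.1 : Fin (2 * L - 1 + 1) → GaugeConfig 3 L SU2), x.2.2)) va ∧
      ∑ va, frameD (fixFrameStd va) (fun M' => Φ (fun k => linkSign k M') (seamSign M') va M')
          (ringCoord L ((Fin.cons (glue x.1) x.2.1 : Fin (2 * L - 1 + 1) → GaugeConfig 3 L SU2), x.2.2)) ≤ 18 * (L : ℝ) ^ 4 - 1 / 2 ∧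
      (∀ k : Fin 3, -(N * Real.sqrt (ringDeficit L (fun _ => false) ((Fin.cons (glue x.1) x.2.1 : Fin (2 * L - 1 + 1) → GaugeConfig 3 L SU2), x.2.2))) ≤
        ∑ va, Φ (fun k => linkSign k (ringCoord L ((Fin.cons (glue x.1) x.2.1 : Fin (2 * L - 1 + 1) → GaugeConfig 3 L SU2), x.2.2)))
            (seamSign (ringCoord L ((Fin.cons (glue x.1) x.2.1 : Fin (2 * L - 1 + 1) → GaugeConfig 3 L SU2), x.2.2))) va
            (ringCoord L ((Fin.cons (glue x.1) x.2.1 : Fin (2 * L - 1 + 1) → GaugeConfig 3 L SU2), x.2.2)) *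
          frameD (fixFrameStd va) (linkMass k) (ringCoord L ((Fin.cons (glue x.1) x.2.1 : Fin (2 * L - 1 + 1) → GaugeConfig 3 L SU2), x.2.2))) ∧
      -(N * Real.sqrt (ringDeficit L (fun _ => false) ((Fin.cons (glue x.1) x.2.1 : Fin (2 * L - 1 + 1) → GaugeConfig 3 L SU2), x.2.2))) ≤
        ∑ va, Φ (fun k => linkSign k (ringCoord L ((Fin.cons (glue x.1) x.2.1 : Fin (2 * L - 1 + 1) → GaugeConfig 3 L SU2), x.2.2)))
            (seamSign (ringCoord L ((Fin.cons (glue x.1) x.2.1 : Fin (2 * L - 1 + 1) → GaugeConfig 3 L SU2), x.2.2))) va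
            (ringCoord L ((Fin.cons (glue x.1) x.2.1 : Fin (2 * L - 1 + 1) → GaugeConfig 3 L SU2), x.2.2)) *
          frameD (fixFrameStd va) seamMass (ringCoord L ((Fin.cons (glue x.1) x.2.1 : Fin (2 * L - 1 + 1) → GaugeConfig 3 L SU2), x.2.2)) := by
  set Mx := ringCoord L ((Fin.cons (glue x.1) x.2.1 : Fin (2 * L - 1 + 1) → GaugeConfig 3 L SU2), x.2.2) with hMx
  have hsel : ∀ k : Fin 3, (linkSign k Mx = 1 ∨ linkSign k Mx = -1) ∧
      1 / 2 ≤ linkSign k Mx * (su2Quat (wrapReps ((Fin.cons (glue x.1) x.2.1 : Fin (2 * L - 1 + 1) → GaugeConfig 3 L SU2) 0) k)).re := by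
    intro k
    rw [hMx, linkSign_fixEmbed]
    have h := signStep_central (r := (su2Quat (wrapReps ((Fin.cons (glue x.1) x.2.1 : Fin (2 * L - 1 + 1) → GaugeConfig 3 L SU2) 0) k)).re)
      (by linarith [hk k])
    exact ⟨h.1, h.2.2⟩
  have hselS : (seamSign Mx = 1 ∨ seamSign Mx = -1) ∧ 1 / 2 ≤ seamSign Mx * (su2Quat (x.2.2 0)).re := by
    rw [hMx, seamSign_ringCoord]
    have h := signStep_central (r := (su2Quat (x.2.2 0)).re) (by linarith [hs])
    exact ⟨h.1, h.2.2⟩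
  have hkm : ∀ k : Fin 3, linkMass k Mx ≤ 3 / 4 := fun k => by rw [hMx, linkMass_fixEmbed]; linarith [hk k]
  have hsm : seamMass Mx ≤ 3 / 4 := by rw [hMx, seamMass_fixEmbed]; linarith [hs]
  obtain ⟨h2, h3, h4, h5⟩ := hP (fun k => linkSign k Mx) (seamSign Mx) (fun k => (hsel k).1) hselS.1 x hk hs (fun k => (hsel k).2) hselS.2 hF
  refine ⟨h2, ?_, h4, h5⟩
  have e : ∀ va, frameD (fixFrameStd va) (fun M' => Φ (fun k => linkSign k M') (seamSign M') va M') Mx =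
      frameD (fixFrameStd va) (Φ (fun k => linkSign k Mx) (seamSign Mx) va) Mx := fun va =>
    frameD_signPlug_eq (fun σ σ₄ M' => Φ σ σ₄ va M') hkm hsm _
  simp only [e]
  exact h3

/-! ## §3 `PeriodicSoftness` from per-sign packages, selectors plugged in -/

/-- ★★★ **`PeriodicSoftness` FROM PER-SIGN CENTRAL PACKAGES (selectors plugged in).**  If for all large `L` there are `ρ ∈ [(K_C L^{q_C})⁻¹, 1/2]`,
`t_C ≥ (K_C L^{q_C})⁻¹`, `0 ≤ N ≤ K_C L^{q_C}`, `ε_C` with `ε_C·L⁴ ≤ 1/400`, and a per-sign family `Φ σ σ₄` of coefficient functions whose plugged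
version `M ↦ Φ (linkSign · M) (seamSign M) va M` is smooth (w2's ✓`contDiff_centralCoeff_sign` for `Φ = centralCoeff L`) and which satisfies, for all
signs `σ_k, σ₄ = ±1`, (P2) `2(1−ε_C)F_fix ≤ Σ Φ·g`, (P3) `Σ ∂Φ ≤ 18L⁴ − 1/2`, (P4) `−N√F_fix ≤ Σ Φ·∂m` at the `ρ`-central window points carrying
those signs — then the deciding crux `VirialFluxGap.PeriodicSoftness` holds BY NAME (✓`centralPackage_of_signPlug` + ✓`periodicSoftness_of_centralField`).
CONDITIONAL on the per-sign packages (w3 lineage). [cite: Luscher1983, §2] -/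
theorem periodicSoftness_of_signPlug
    (h : ∃ K_C : ℝ, 1 ≤ K_C ∧ ∃ q_C : ℕ, ∃ L₀ : ℕ, ∀ (L : ℕ) [NeZero L], L₀ ≤ L →
      ∃ (ρ t_C N ε_C : ℝ)
        (Φ : (Fin 3 → ℝ) → ℝ → FixVar L × Fin 3 →
          ((Fin (2 * L - 1 + 1) → Edge 3 L → Matrix (Fin 2) (Fin 2) ℂ) × (Site 3 L → Matrix (Fin 2) (Fin 2) ℂ)) → ℝ),
        (K_C * (L : ℝ) ^ q_C)⁻¹ ≤ ρ ∧ ρ ≤ 1 / 2 ∧ (K_C * (L : ℝ) ^ q_C)⁻¹ ≤ t_C ∧ 0 ≤ N ∧ N ≤ K_C * (L : ℝ) ^ q_C ∧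
        ε_C * (L : ℝ) ^ 4 ≤ 1 / 400 ∧
        (∀ va, ContDiff ℝ ∞ fun M : ((Fin (2 * L - 1 + 1) → Edge 3 L → Matrix (Fin 2) (Fin 2) ℂ) × (Site 3 L → Matrix (Fin 2) (Fin 2) ℂ)) =>
          Φ (fun k => linkSign k M) (seamSign M) va M) ∧
        ∀ (σ : Fin 3 → ℝ) (σ₄ : ℝ), (∀ k, σ k = 1 ∨ σ k = -1) → (σ₄ = 1 ∨ σ₄ = -1) →
          ∀ x : (OffIdx L → SU2) × ((Fin (2 * L - 1) → GaugeConfig 3 L SU2) × (Site 3 L → SU2)),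
          (∀ k : Fin 3, 1 - (su2Quat (wrapReps ((Fin.cons (glue x.1) x.2.1 : Fin (2 * L - 1 + 1) → GaugeConfig 3 L SU2) 0) k)).re ^ 2 ≤ ρ ^ 2) →
          1 - (su2Quat (x.2.2 0)).re ^ 2 ≤ ρ ^ 2 →
          (∀ k : Fin 3, 1 / 2 ≤ σ k * (su2Quat (wrapReps ((Fin.cons (glue x.1) x.2.1 : Fin (2 * L - 1 + 1) → GaugeConfig 3 L SU2) 0) k)).re) →
          1 / 2 ≤ σ₄ * (su2Quat (x.2.2 0)).re →
          ringDeficit L (fun _ => false) ((Fin.cons (glue x.1) x.2.1 : Fin (2 * L - 1 + 1) → GaugeConfig 3 L SU2), x.2.2) ≤ t_C →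
          2 * (1 - ε_C) * ringDeficit L (fun _ => false) ((Fin.cons (glue x.1) x.2.1 : Fin (2 * L - 1 + 1) → GaugeConfig 3 L SU2), x.2.2) ≤
              ∑ va, Φ σ σ₄ va (ringCoord L ((Fin.cons (glue x.1) x.2.1 : Fin (2 * L - 1 + 1) → GaugeConfig 3 L SU2), x.2.2)) *
                frameGrad (L := L) fixFrameStd (ringCoord L ((Fin.cons (glue x.1) x.2.1 : Fin (2 * L - 1 + 1) → GaugeConfig 3 L SU2), x.2.2)) va ∧
            ∑ va, frameD (fixFrameStd va) (Φ σ σ₄ va) (ringCoord L ((Fin.cons (glue x.1) x.2.1 : Fin (2 * L - 1 + 1) → GaugeConfig 3 L SU2), x.2.2)) ≤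
              18 * (L : ℝ) ^ 4 - 1 / 2 ∧
            (∀ k : Fin 3, -(N * Real.sqrt (ringDeficit L (fun _ => false) ((Fin.cons (glue x.1) x.2.1 : Fin (2 * L - 1 + 1) → GaugeConfig 3 L SU2), x.2.2))) ≤
              ∑ va, Φ σ σ₄ va (ringCoord L ((Fin.cons (glue x.1) x.2.1 : Fin (2 * L - 1 + 1) → GaugeConfig 3 L SU2), x.2.2)) *
                frameD (fixFrameStd va) (linkMass k) (ringCoord L ((Fin.cons (glue x.1) x.2.1 : Fin (2 * L - 1 + 1) → GaugeConfig 3 L SU2), x.2.2))) ∧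
            -(N * Real.sqrt (ringDeficit L (fun _ => false) ((Fin.cons (glue x.1) x.2.1 : Fin (2 * L - 1 + 1) → GaugeConfig 3 L SU2), x.2.2))) ≤
              ∑ va, Φ σ σ₄ va (ringCoord L ((Fin.cons (glue x.1) x.2.1 : Fin (2 * L - 1 + 1) → GaugeConfig 3 L SU2), x.2.2)) *
                frameD (fixFrameStd va) seamMass (ringCoord L ((Fin.cons (glue x.1) x.2.1 : Fin (2 * L - 1 + 1) → GaugeConfig 3 L SU2), x.2.2))) :
    Summit.QuantumFields.YangMills.Theses.VirialFluxGap.PeriodicSoftness := by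
  obtain ⟨K_C, hK_C, q_C, L₀, hpack⟩ := h
  refine periodicSoftness_of_centralField ⟨K_C, hK_C, q_C, L₀, fun L _ hL => ?_⟩
  obtain ⟨ρ, t_C, N, ε_C, Φ, hρlo, hρhi, htC, hN0, hN, hεC, hCs, hP⟩ := hpack L hL
  have hρ0 : 0 < ρ := by
    have hKC0 : 0 < K_C := by linarith
    have hL0 : (0 : ℝ) < L := by exact_mod_cast NeZero.pos L
    have : (0 : ℝ) < (K_C * (L : ℝ) ^ q_C)⁻¹ := by positivity
    linarith
  have hρ2 : ρ ^ 2 ≤ 3 / 4 := by nlinarith only [hρ0, hρhi]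
  exact ⟨ρ, t_C, N, ε_C, fun va M => Φ (fun k => linkSign k M) (seamSign M) va M, hρlo, hρhi, htC, hN0, hN, hεC, hCs,
    fun x hk hs hF => centralPackage_of_signPlug (L := L) hρ2 Φ hP x hk hs hF⟩

end Summit.QuantumFields.YangMills.Theorems.VirialFluxGap.FrameHessian

end
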